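import Literature.MathematicalPhysics.QuantumManyBody.BogoliubovWeylReduction
import Mathlib.RingTheory.MvPolynomial.WeightedHomogeneous
import HarnessLib

/-!
# Bogoliubov expansion of the conjugated functional, I: graded vanishing of expectations and
# `∑_p w_p‖B_pξ‖² = (∑ w_pσ_p²)‖ξ‖² + ∑ w_p(γ_p²+σ_p²)‖a_pξ‖² + 2Re∑ w_pγ_pσ_p⟨a_{σp}a_pξ, ξ⟩`

Topic `Literature/MathematicalPhysics/QuantumManyBody`, namespace `BoseGas.Fock`; sequel of
`BogoliubovWeylReduction.lean` (`B_q = bogAn = γ_qa_q + σ_qa†_{σq} = T*a_qT`, the Weyl reduction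
`∑ ε(p)‖A_pξ‖² = ∑ ε(p)‖B_pξ‖²`), for the provefact
`Literature.MathematicalPhysics.QuantumManyBody.BoseGas.BastiCenatiempoSchlein2021_upperBound`
(§4 of [BastiCenatiempoSchlein2021]: the conjugation of `ℒ^{(j)}_N` by the Bogoliubov
transformation and the resulting normal-ordered expansion).

* **Graded vanishing** (`fockInner_eq_zero_of_isWeightedHomogeneous_ne`,
  `isWeightedHomogeneous_X_mul'`, `isWeightedHomogeneous_pderiv`): for any additive weight
  `w : ι → M` on the modes, creation raises and annihilation lowers the weight of a weighted-
  homogeneous vector, and vectors of different weights are Fock-orthogonal. This is how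
  [ibid., §4] discards terms: `⟨ξ_ν, E₂ξ_ν⟩ = 0` "since `ξ_ν` is a superposition of states with `3m`
  particles", `⟨ξ_ν, a†_pa†_{-p}ξ_ν⟩ = 0`, "`ξ_ν` is a superposition of vectors with `2m` particles
  with momenta in `P_H` and `m` particles with momenta in `P_S`" (weight `1` on `P_H`, `-2` on
  `P_S`), and momentum conservation (weight `p ↦ p ∈ ℤ³`).
* **The kinetic expansion** (`sum_mul_fockInner_bogAn_self_re`): for even data and an even weight,
  `∑_p w_p‖B_pξ‖² = (∑_p w_pσ_p²)‖ξ‖² + ∑_p w_p(γ_p² + σ_p²)‖a_pξ‖² + 2Re∑_p w_pγ_pσ_p⟨a_{σp}a_pξ, ξ⟩`,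
  i.e. `T*𝒦T = ∑p²σ_p² + ∑p²(γ_p²+σ_p²)a†_pa_p + ∑p²γ_pσ_p(a_pa_{-p} + h.c.)` [ibid., §4, display
  after (4.0): `T*𝒦T - [𝒦 + ∑p²σ_p²] = E₁ + E₂`], and its graded form
  (`sum_mul_fockInner_bogAn_self_re_of_graded`) in which the pair term `E₂` drops out.

* **Graded expansions of the pair, cubic and quartic words** (`fockInner_bogAn_bogAn'_of_graded`,
  `fockInner_self_bogAn_bogAn_of_graded`, `fockInner_bogAn_bogAn_bogAn_of_graded`,
  `fockInner_bogAn_bogAn_of_graded`): for a vector graded by a constant weight `g` (`ξ_ν`: `g = 1`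
  in `ℤ/3ℤ`), the pairings changing the particle number differently are orthogonal; what survives
  is the structure `E₁ + E₂`, `𝒢^{(2,V)}`, `𝒞_N + F₁ + F₂ + F₃ + h.c.`, `G₁ + G₂ + G₃` of [ibid., §4],
  normal ordered by the Wick rules `fockInner_X_mul_X_mul`, `fockInner_X_mul_X_mul_X_mul_X_mul`.
* **II. The momentum-conserving quartic form** (`sum_pairCoeff_fockInner_conjPair_conjPair`): with
  injective momentum labels `e : ι → ℤ³`, `e z = 0`, `e ∘ σ = -e` and the pair coefficient
  `pairCoeff' e W p q p' q' = [e p + e q = e p' + e q'] W(e p' - e p)` of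
  `(2|Λ|)⁻¹∑V̂(r)a†_{p+r}a†_qa_{q+r}a_p` [ibid., (2.1)], the sixteen-term Weyl reduction collapses for
  `a_zξ = 0` to `ℒ⁽⁴⁾ + √N₀ℒ⁽³⁾ + N₀ℒ⁽²⁾ + N₀²W(0)‖ξ‖²` (four cubic and two quadratic momentum sums
  written out; `ℒ⁽¹⁾` absent) — the substitution `a_0 → √N₀` of [ibid., (3.2)] followed by `T*·T`.

## References

* [BastiCenatiempoSchlein2021] G. Basti, S. Cenatiempo, B. Schlein, Forum Math. Sigma 9 (2021) e74,
  arXiv:2101.06222: (2.1), (3.1)–(3.2); §4, the treatment of `𝒢^{(2)}_N` (`E₁`, `E₂`),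
  `𝒢^{(3)}_N`, `𝒢^{(4)}_N = G₁ + G₂ + G₃`.
* Mathlib: `MvPolynomial.IsWeightedHomogeneous`, `Finsupp.weight`.
-/

noncomputable section

namespace Literature.MathematicalPhysics.QuantumManyBody.BoseGas

open Complex MvPolynomial Finset
open scoped ComplexConjugate BigOperators

namespace Fock

variable {ι : Type*}

/-! ### Graded vanishing of Fock expectations -/

section Graded

variable {M : Type*} [AddCommGroup M] {w : ι → M}

/-- **Vectors of different weights are orthogonal.** [folklore] -/
theorem fockInner_eq_zero_of_isWeightedHomogeneous_ne {u v : MvPolynomial ι ℂ} {m n : M}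
    (hu : IsWeightedHomogeneous w u m) (hv : IsWeightedHomogeneous w v n) (hmn : m ≠ n) :
    fockInner u v = 0 := by
  unfold fockInner
  refine Finset.sum_eq_zero fun d hd => ?_
  have hcu : coeff d u ≠ 0 := mem_support_iff.1 hd
  have hcv : coeff d v = 0 := by
    by_contra h
    exact hmn ((hu hcu).symm.trans (hv h))
  rw [hcv, mul_zero, mul_zero]

/-- **Creation raises the weight**: `X_i u` has weight `w i + m`. [folklore] -/
theorem isWeightedHomogeneous_X_mul' {u : MvPolynomial ι ℂ} {m : M} (hu : IsWeightedHomogeneous w u m)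
    (i : ι) : IsWeightedHomogeneous w (X i * u) (w i + m) :=
  (isWeightedHomogeneous_X ℂ w i).mul hu

/-- **Annihilation lowers the weight**: `∂_i u` has weight `m - w i`. [folklore] -/
theorem isWeightedHomogeneous_pderiv {u : MvPolynomial ι ℂ} {m : M} (hu : IsWeightedHomogeneous w u m)
    (i : ι) : IsWeightedHomogeneous w (pderiv i u) (m - w i) := by
  intro d hd
  rw [coeff_pderiv] at hd
  have h1 : coeff (d + Finsupp.single i 1) u ≠ 0 := fun h => hd (by rw [h, zero_mul])
  have h2 := hu h1
  rw [map_add, Finsupp.weight_single, one_smul] at h2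
  exact eq_sub_of_add_eq h2

/-- Scalar multiples keep the weight. [folklore] -/
theorem isWeightedHomogeneous_C_mul' {u : MvPolynomial ι ℂ} {m : M} (hu : IsWeightedHomogeneous w u m)
    (a : ℂ) : IsWeightedHomogeneous w (C a * u) m := by
  simpa using hu.C_mul a

/-- **`⟨∂_j∂_iξ, ξ⟩ = 0` unless `w i + w j = 0`** for a weighted-homogeneous `ξ` (pair
annihilation changes the weight). [cite: BastiCenatiempoSchlein2021, §4 (`⟨ξ_ν, E₂ξ_ν⟩ = 0`)] -/
theorem fockInner_pderiv_pderiv_self_eq_zero {ξ : MvPolynomial ι ℂ} {m : M}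
    (hξ : IsWeightedHomogeneous w ξ m) {i j : ι} (hij : w i + w j ≠ 0) :
    fockInner (pderiv j (pderiv i ξ)) ξ = 0 := by
  refine fockInner_eq_zero_of_isWeightedHomogeneous_ne
    (isWeightedHomogeneous_pderiv (isWeightedHomogeneous_pderiv hξ i) j) hξ ?_
  intro h
  apply hij
  have h' : m - (w i + w j) = m := by rw [← sub_sub]; exact h
  exact sub_eq_self.1 h'

/-- **`⟨∂_iξ, ξ⟩ = 0` unless `w i = 0`.** [folklore] -/
theorem fockInner_pderiv_self_eq_zero {ξ : MvPolynomial ι ℂ} {m : M}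
    (hξ : IsWeightedHomogeneous w ξ m) {i : ι} (hi : w i ≠ 0) :
    fockInner (pderiv i ξ) ξ = 0 := by
  refine fockInner_eq_zero_of_isWeightedHomogeneous_ne (isWeightedHomogeneous_pderiv hξ i) hξ ?_
  intro h
  exact hi (sub_eq_self.1 h)

/-- **`⟨∂_iξ, ∂_jξ⟩ = 0` unless `w i = w j`** (e.g. momentum conservation:
`⟨ξ, a†_pa_qξ⟩ = 0` for `p ≠ q` when `ξ` has definite total momentum). [folklore] -/
theorem fockInner_pderiv_pderiv_eq_zero {ξ : MvPolynomial ι ℂ} {m : M}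
    (hξ : IsWeightedHomogeneous w ξ m) {i j : ι} (hij : w i ≠ w j) :
    fockInner (pderiv i ξ) (pderiv j ξ) = 0 := by
  refine fockInner_eq_zero_of_isWeightedHomogeneous_ne (isWeightedHomogeneous_pderiv hξ i)
    (isWeightedHomogeneous_pderiv hξ j) ?_
  intro h
  exact hij (sub_right_inj.1 h)

end Graded

/-! ### Normal ordering of Fock inner products of short words (Wick's rule for one and two creators) -/

section NormalOrder

variable [DecidableEq ι]

/-- CCR in polynomial form: `∂_q(X_kξ) = X_k∂_qξ + [q = k]ξ`. [cite: LSSY2005, App. A (A.7)] -/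
theorem pderiv_X_mul (q k : ι) (ξ : MvPolynomial ι ℂ) :
    pderiv q (X k * ξ) = X k * pderiv q ξ + if q = k then ξ else 0 :=
  an_cr_apply q k ξ

omit [DecidableEq ι] in
/-- `⟨X_lu, ∂_ku'⟩ = ⟨u, ∂_l∂_ku'⟩`. [cite: LSSY2005, App. A (after (A.6))] -/
theorem fockInner_X_mul_pderiv (l k : ι) (u u' : MvPolynomial ι ℂ) :
    fockInner (X l * u) (pderiv k u') = fockInner u (pderiv l (pderiv k u')) := by
  rw [← cr_apply, fockInner_cr_left, an_apply]

/-- **One creator on each side**: `⟨X_lu, X_{l'}u'⟩ = ⟨∂_{l'}u, ∂_lu'⟩ + [l = l']⟨u, u'⟩`.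
[cite: LSSY2005, App. A (A.7)] -/
theorem fockInner_X_mul_X_mul (l l' : ι) (u u' : MvPolynomial ι ℂ) :
    fockInner (X l * u) (X l' * u') =
      fockInner (pderiv l' u) (pderiv l u') + if l = l' then fockInner u u' else 0 := by
  rw [← cr_apply, fockInner_cr_left, an_apply, pderiv_X_mul, fockInner_add_right,
    fockInner_X_mul_right]
  by_cases h : l = l'
  · rw [if_pos h, if_pos h]
  · rw [if_neg h, if_neg h, fockInner_zero_right]

omit [DecidableEq ι] in
/-- `⟨X_la, b⟩ = ⟨a, ∂_lb⟩` (creation on the left). [cite: LSSY2005, App. A (after (A.6))] -/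
theorem fockInner_X_mul_left (l : ι) (a b : MvPolynomial ι ℂ) :
    fockInner (X l * a) b = fockInner a (pderiv l b) := by
  rw [← cr_apply, fockInner_cr_left, an_apply]

omit [DecidableEq ι] in
/-- `⟨[c]x, y⟩ = [c]⟨x, y⟩`. [folklore] -/
theorem fockInner_ite_left (c : Prop) [Decidable c] (x y : MvPolynomial ι ℂ) :
    fockInner (if c then x else 0) y = if c then fockInner x y else 0 := by
  split_ifs
  · rfl
  · exact fockInner_zero_left _

omit [DecidableEq ι] in
/-- `⟨x, [c]y⟩ = [c]⟨x, y⟩`. [folklore] -/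
theorem fockInner_ite_right (c : Prop) [Decidable c] (x y : MvPolynomial ι ℂ) :
    fockInner x (if c then y else 0) = if c then fockInner x y else 0 := by
  split_ifs
  · rfl
  · exact fockInner_zero_right _

/-- **Two creators on each side** (Wick's rule):
`⟨X_kX_lu, X_{k'}X_{l'}u'⟩ = ⟨∂_{l'}∂_{k'}u, ∂_l∂_ku'⟩ + [l=l']⟨∂_{k'}u, ∂_ku'⟩ + [k=l']⟨∂_{k'}u, ∂_lu'⟩
  + [k'=l]⟨∂_{l'}u, ∂_ku'⟩ + [k'=l][k=l']⟨u, u'⟩ + [k=k'](⟨∂_{l'}u, ∂_lu'⟩ + [l=l']⟨u, u'⟩)`.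
[cite: BastiCenatiempoSchlein2021, §4 (normal ordering of `G₃`)] -/
theorem fockInner_X_mul_X_mul_X_mul_X_mul (k l k' l' : ι) (u u' : MvPolynomial ι ℂ) :
    fockInner (X k * (X l * u)) (X k' * (X l' * u')) =
      fockInner (pderiv l' (pderiv k' u)) (pderiv l (pderiv k u')) +
      (if l = l' then fockInner (pderiv k' u) (pderiv k u') else 0) +
      (if k = l' then fockInner (pderiv k' u) (pderiv l u') else 0) +
      (if k' = l then fockInner (pderiv l' u) (pderiv k u') else 0) +
      (if k' = l then if k = l' then fockInner u u' else 0 else 0) +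
      (if k = k' then fockInner (pderiv l' u) (pderiv l u') + (if l = l' then fockInner u u' else 0)
        else 0) := by
  rw [fockInner_X_mul_X_mul, pderiv_X_mul, pderiv_X_mul, fockInner_add_left, fockInner_add_right,
    fockInner_add_right, fockInner_X_mul_X_mul, fockInner_ite_right, fockInner_X_mul_left,
    fockInner_ite_left, fockInner_ite_left, fockInner_X_mul_right, fockInner_ite_right,
    fockInner_X_mul_X_mul]
  ring

end NormalOrder

/-! ### The kinetic expansion `∑ w_p ‖B_pξ‖²` -/

section Kinetic

variable [Fintype ι] [DecidableEq ι] {σ : ι → ι} {P : Finset ι} {t : ι → ℝ}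

omit [Fintype ι] in
/-- **`‖B_pξ‖²` expanded**:
`‖B_pξ‖² = γ_p²‖a_pξ‖² + σ_p²(‖ξ‖² + ‖a_{σp}ξ‖²) + 2γ_pσ_p Re⟨a_{σp}a_pξ, ξ⟩` (CCR
`‖a†_kξ‖² = ‖ξ‖² + ‖a_kξ‖²` and adjointness). [cite: BastiCenatiempoSchlein2021, §4 (`T*𝒦T`)] -/
theorem fockInner_bogAn_self_re (p : ι) (ξ : MvPolynomial ι ℂ) :
    (fockInner (bogAn σ P t p ξ) (bogAn σ P t p ξ)).re =
      bogGamma σ P t p ^ 2 * (fockInner (pderiv p ξ) (pderiv p ξ)).re +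
      bogSigma σ P t p ^ 2 * ((fockInner ξ ξ).re + (fockInner (pderiv (σ p) ξ) (pderiv (σ p) ξ)).re) +
      2 * (bogGamma σ P t p * bogSigma σ P t p) * (fockInner (pderiv (σ p) (pderiv p ξ)) ξ).re := by
  rw [bogAn_apply]
  simp only [fockInner_add_left, fockInner_add_right, fockInner_C_mul_left, fockInner_C_mul_right,
    Complex.conj_ofReal]
  have hsymm : fockInner (X (σ p) * ξ) (pderiv p ξ) = conj (fockInner (pderiv (σ p) (pderiv p ξ)) ξ) := by
    rw [← fockInner_X_mul_right, conj_fockInner]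
  rw [fockInner_X_mul_self, fockInner_X_mul_right (σ p) ξ (pderiv p ξ), hsymm]
  simp only [Complex.add_re, Complex.mul_re, Complex.ofReal_re, Complex.ofReal_im, Complex.conj_re,
    Complex.conj_im, zero_mul, sub_zero]
  ring

/-- **The kinetic expansion `T*(∑ w_pa†_pa_p)T`.** For pair data even under the involution `σ`
(`γ_{σp} = γ_p`, `σ_{σp} = σ_p`, automatic) and an even weight `w_{σp} = w_p` (e.g. `w_p = |p|²`),
`∑_p w_p‖B_pξ‖² = (∑_p w_pσ_p²)‖ξ‖² + ∑_p w_p(γ_p² + σ_p²)‖a_pξ‖² + 2∑_p w_pγ_pσ_p Re⟨a_{σp}a_pξ, ξ⟩`,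
i.e. `T*𝒦T = ∑p²σ_p² + ∑p²(γ_p²+σ_p²)a†_pa_p + ∑p²γ_pσ_p(a_pa_{-p} + h.c.)`.
[cite: BastiCenatiempoSchlein2021, §4 (`T*𝒦T - [𝒦 + ∑p²σ_p²] = E₁ + E₂`)] -/
theorem sum_mul_fockInner_bogAn_self_re (hσ : Function.Involutive σ) (hP : ∀ p ∈ P, σ p ∉ P)
    (w : ι → ℝ) (hw : ∀ p, w (σ p) = w p) (ξ : MvPolynomial ι ℂ) :
    ∑ p, w p * (fockInner (bogAn σ P t p ξ) (bogAn σ P t p ξ)).re =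
      (∑ p, w p * bogSigma σ P t p ^ 2) * (fockInner ξ ξ).re +
      ∑ p, w p * (bogGamma σ P t p ^ 2 + bogSigma σ P t p ^ 2) *
        (fockInner (pderiv p ξ) (pderiv p ξ)).re +
      2 * ∑ p, w p * (bogGamma σ P t p * bogSigma σ P t p) *
        (fockInner (pderiv (σ p) (pderiv p ξ)) ξ).re := by
  simp only [fockInner_bogAn_self_re]
  -- reindex the `‖a_{σp}ξ‖²` term along the involution
  have hre : ∑ p, w p * bogSigma σ P t p ^ 2 * (fockInner (pderiv (σ p) ξ) (pderiv (σ p) ξ)).re =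
      ∑ p, w p * bogSigma σ P t p ^ 2 * (fockInner (pderiv p ξ) (pderiv p ξ)).re := by
    rw [← Equiv.sum_comp (hσ.toPerm σ)]
    refine Finset.sum_congr rfl fun p _ => ?_
    rw [Function.Involutive.coe_toPerm, hw, bogSigma_partner hσ hP, hσ p]
  rw [Finset.sum_mul, Finset.mul_sum]
  have hsplit : ∀ p, w p * (bogGamma σ P t p ^ 2 * (fockInner (pderiv p ξ) (pderiv p ξ)).re +
      bogSigma σ P t p ^ 2 * ((fockInner ξ ξ).re + (fockInner (pderiv (σ p) ξ) (pderiv (σ p) ξ)).re) +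
      2 * (bogGamma σ P t p * bogSigma σ P t p) * (fockInner (pderiv (σ p) (pderiv p ξ)) ξ).re) =
      w p * bogSigma σ P t p ^ 2 * (fockInner ξ ξ).re +
      (w p * bogGamma σ P t p ^ 2 * (fockInner (pderiv p ξ) (pderiv p ξ)).re +
        w p * bogSigma σ P t p ^ 2 * (fockInner (pderiv (σ p) ξ) (pderiv (σ p) ξ)).re) +
      2 * (w p * (bogGamma σ P t p * bogSigma σ P t p) * (fockInner (pderiv (σ p) (pderiv p ξ)) ξ).re) := by
    intro p; ring
  simp only [hsplit, Finset.sum_add_distrib, hre]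
  rw [← Finset.sum_add_distrib]
  congr 1
  congr 1
  refine Finset.sum_congr rfl fun p _ => ?_
  ring

/-- **The kinetic expansion for a graded vector**: if `ξ` is weighted-homogeneous for a weight
`wt` with `wt(σp) + wt(p) ≠ 0` whenever `a_pξ ≠ 0` matters — precisely, `∂_pξ = 0` for the modes
with `wt p + wt(σp) = 0` — then the pair term drops out:
`∑_p w_p‖B_pξ‖² = (∑_p w_pσ_p²)‖ξ‖² + ∑_p w_p(γ_p² + σ_p²)‖a_pξ‖²`
(for `ξ_ν`: `⟨ξ_ν, E₂ξ_ν⟩ = 0`, `ξ_ν` being a superposition of `3m`-particle states, and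
`a_pξ_ν = 0` off `P_S ∪ P_H`). [cite: BastiCenatiempoSchlein2021, §4 (`E₁`, `E₂`)] -/
theorem sum_mul_fockInner_bogAn_self_re_of_graded {M : Type*} [AddCommGroup M] {wt : ι → M}
    (hσ : Function.Involutive σ) (hP : ∀ p ∈ P, σ p ∉ P) (w : ι → ℝ) (hw : ∀ p, w (σ p) = w p)
    {ξ : MvPolynomial ι ℂ} {m : M} (hξ : IsWeightedHomogeneous wt ξ m)
    (hvan : ∀ p, wt p + wt (σ p) = 0 → pderiv p ξ = 0) :
    ∑ p, w p * (fockInner (bogAn σ P t p ξ) (bogAn σ P t p ξ)).re =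
      (∑ p, w p * bogSigma σ P t p ^ 2) * (fockInner ξ ξ).re +
      ∑ p, w p * (bogGamma σ P t p ^ 2 + bogSigma σ P t p ^ 2) *
        (fockInner (pderiv p ξ) (pderiv p ξ)).re := by
  rw [sum_mul_fockInner_bogAn_self_re hσ hP w hw]
  have h0 : ∀ p, (fockInner (pderiv (σ p) (pderiv p ξ)) ξ).re = 0 := by
    intro p
    by_cases hp : wt p + wt (σ p) = 0
    · rw [hvan p hp, map_zero, fockInner_zero_left, Complex.zero_re]
    · rw [fockInner_pderiv_pderiv_self_eq_zero hξ hp, Complex.zero_re]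
  simp [h0]

end Kinetic

/-! ### The quartic words `B_qB_pξ` and their graded expansion -/

section QuarticWords

variable [DecidableEq ι] {σ : ι → ι} {P : Finset ι} {t : ι → ℝ}

omit [DecidableEq ι] in
/-- Transport of weighted homogeneity along an equality of weights. [folklore] -/
theorem _root_.MvPolynomial.IsWeightedHomogeneous.of_eq {M : Type*} [AddCommMonoid M] {w : ι → M}
    {φ : MvPolynomial ι ℂ} {n n' : M} (h : IsWeightedHomogeneous w φ n) (e : n = n') :
    IsWeightedHomogeneous w φ n' := e ▸ h

/-- **`B_qB_pξ` expanded**: `B_qB_pξ = γ_qγ_p ∂_q∂_pξ + γ_qσ_p ∂_q(X_{σp}ξ) + σ_qγ_p X_{σq}∂_pξ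
+ σ_qσ_p X_{σq}X_{σp}ξ` (pair annihilation `D`, number-type words `Z`, pair creation `U`).
[cite: BastiCenatiempoSchlein2021, §4 (`𝒢^{(4)}_N = G₁ + G₂ + G₃`)] -/
theorem bogAn_bogAn_apply (p q : ι) (ξ : MvPolynomial ι ℂ) :
    bogAn σ P t q (bogAn σ P t p ξ) =
      C ((bogGamma σ P t q * bogGamma σ P t p : ℝ) : ℂ) * pderiv q (pderiv p ξ) +
      (C ((bogGamma σ P t q * bogSigma σ P t p : ℝ) : ℂ) * pderiv q (X (σ p) * ξ) +
        C ((bogSigma σ P t q * bogGamma σ P t p : ℝ) : ℂ) * (X (σ q) * pderiv p ξ)) +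
      C ((bogSigma σ P t q * bogSigma σ P t p : ℝ) : ℂ) * (X (σ q) * (X (σ p) * ξ)) := by
  rw [bogAn_apply, bogAn_apply, map_add, pderiv_C_mul, pderiv_C_mul]
  push_cast
  simp only [map_mul]
  ring

omit [DecidableEq ι] in
/-- Three mutually orthogonal classes on each side: only the diagonal pairings survive. [folklore] -/
theorem fockInner_add₃_of_orthogonal {D Z U D' Z' U' : MvPolynomial ι ℂ}
    (h1 : fockInner D Z' = 0) (h2 : fockInner D U' = 0) (h3 : fockInner Z D' = 0)
    (h4 : fockInner Z U' = 0) (h5 : fockInner U D' = 0) (h6 : fockInner U Z' = 0) :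
    fockInner (D + Z + U) (D' + Z' + U') = fockInner D D' + fockInner Z Z' + fockInner U U' := by
  simp only [fockInner_add_left, fockInner_add_right, h1, h2, h3, h4, h5, h6, add_zero, zero_add]

/-- **The graded expansion of `⟨B_qB_pξ, B_{q'}B_{p'}ξ⟩`.** If `ξ` is weighted-homogeneous for a
constant weight `g` with `2g ≠ 0` and `4g ≠ 0` (e.g. `g = 1 ∈ ℤ/3ℤ`: `ξ_ν` is a superposition of
`3m`-particle states), the words changing the particle number by different amounts are orthogonal,
and only the `DD`, `ZZ` and `UU` pairings survive:
`⟨B_qB_pξ, B_{q'}B_{p'}ξ⟩ = γ_qγ_pγ_{q'}γ_{p'}⟨∂_q∂_pξ, ∂_{q'}∂_{p'}ξ⟩ + ⟨Z_{qp}ξ, Z_{q'p'}ξ⟩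
  + σ_qσ_pσ_{q'}σ_{p'}⟨X_{σq}X_{σp}ξ, X_{σq'}X_{σp'}ξ⟩`
— the terms `G₁`, `G₂`, `G₃` of [ibid., §4] before normal ordering.
[cite: BastiCenatiempoSchlein2021, §4 (`⟨ξ_ν, 𝒢^{(4)}_Nξ_ν⟩ = ∑_{j=1}^3 ⟨ξ_ν, G_jξ_ν⟩`)] -/
theorem fockInner_bogAn_bogAn_of_graded {M : Type*} [AddCommGroup M] {g : M} (h2 : 2 • g ≠ 0)
    (h4 : 4 • g ≠ 0) {ξ : MvPolynomial ι ℂ} {m : M} (hξ : IsWeightedHomogeneous (fun _ : ι => g) ξ m)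
    (p q p' q' : ι) :
    fockInner (bogAn σ P t q (bogAn σ P t p ξ)) (bogAn σ P t q' (bogAn σ P t p' ξ)) =
      ((bogGamma σ P t q * bogGamma σ P t p * (bogGamma σ P t q' * bogGamma σ P t p') : ℝ) : ℂ) *
        fockInner (pderiv q (pderiv p ξ)) (pderiv q' (pderiv p' ξ)) +
      fockInner
        (C ((bogGamma σ P t q * bogSigma σ P t p : ℝ) : ℂ) * pderiv q (X (σ p) * ξ) +
          C ((bogSigma σ P t q * bogGamma σ P t p : ℝ) : ℂ) * (X (σ q) * pderiv p ξ))
        (C ((bogGamma σ P t q' * bogSigma σ P t p' : ℝ) : ℂ) * pderiv q' (X (σ p') * ξ) +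
          C ((bogSigma σ P t q' * bogGamma σ P t p' : ℝ) : ℂ) * (X (σ q') * pderiv p' ξ)) +
      ((bogSigma σ P t q * bogSigma σ P t p * (bogSigma σ P t q' * bogSigma σ P t p') : ℝ) : ℂ) *
        fockInner (X (σ q) * (X (σ p) * ξ)) (X (σ q') * (X (σ p') * ξ)) := by
  -- weights of the three classes
  have hD : ∀ a b : ι, IsWeightedHomogeneous (fun _ : ι => g) (pderiv a (pderiv b ξ)) (m - g - g) :=
    fun a b => isWeightedHomogeneous_pderiv (isWeightedHomogeneous_pderiv hξ b) a
  have hZ : ∀ (a b c d : ι) (x y : ℂ), IsWeightedHomogeneous (fun _ : ι => g)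
      (C x * pderiv a (X b * ξ) + C y * (X c * pderiv d ξ)) m := by
    intro a b c d x y
    refine (isWeightedHomogeneous_C_mul' ((isWeightedHomogeneous_pderiv
      (isWeightedHomogeneous_X_mul' hξ b) a).of_eq (by abel)) x).add
      (isWeightedHomogeneous_C_mul' ((isWeightedHomogeneous_X_mul'
        (isWeightedHomogeneous_pderiv hξ d) c).of_eq (by abel)) y)
  have hU : ∀ a b : ι, IsWeightedHomogeneous (fun _ : ι => g) (X a * (X b * ξ)) (g + (g + m)) :=
    fun a b => isWeightedHomogeneous_X_mul' (isWeightedHomogeneous_X_mul' hξ b) a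
  have hDZ : m - g - g ≠ m := by
    intro h; apply h2
    have h' : m - (g + g) = m := by rw [← sub_sub]; exact h
    rw [two_nsmul]; exact sub_eq_self.1 h'
  have hDU : m - g - g ≠ g + (g + m) := by
    intro h; apply h4
    have h' : (4 : ℕ) • g = (g + (g + m)) - (m - g - g) := by simp only [succ_nsmul, zero_nsmul]; abel
    rw [h', h, sub_self]
  have hZU : m ≠ g + (g + m) := by
    intro h; apply h2
    have h' : (2 : ℕ) • g = (g + (g + m)) - m := by rw [two_nsmul]; abel
    rw [h', ← h, sub_self]
  rw [bogAn_bogAn_apply, bogAn_bogAn_apply,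
    fockInner_add₃_of_orthogonal
      (fockInner_eq_zero_of_isWeightedHomogeneous_ne ((hD q p).C_mul _) (hZ _ _ _ _ _ _) hDZ)
      (fockInner_eq_zero_of_isWeightedHomogeneous_ne ((hD q p).C_mul _) ((hU _ _).C_mul _) hDU)
      (fockInner_eq_zero_of_isWeightedHomogeneous_ne (hZ _ _ _ _ _ _) ((hD q' p').C_mul _) hDZ.symm)
      (fockInner_eq_zero_of_isWeightedHomogeneous_ne (hZ _ _ _ _ _ _) ((hU _ _).C_mul _) hZU)
      (fockInner_eq_zero_of_isWeightedHomogeneous_ne ((hU _ _).C_mul _) ((hD q' p').C_mul _) hDU.symm)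
      (fockInner_eq_zero_of_isWeightedHomogeneous_ne ((hU _ _).C_mul _) (hZ _ _ _ _ _ _) hZU.symm)]
  simp only [fockInner_C_mul_left, fockInner_C_mul_right, Complex.conj_ofReal]
  push_cast
  ring

/-- **`⟨ξ, B_qξ⟩ = 0`** for a graded `ξ` (`g ≠ 0`): the linear terms of the Weyl reduction vanish.
[cite: BastiCenatiempoSchlein2021, §4 (`𝒢^{(1)}`-type terms absent)] -/
theorem fockInner_self_bogAn_of_graded {M : Type*} [AddCommGroup M] {g : M} (h1 : g ≠ 0)
    {ξ : MvPolynomial ι ℂ} {m : M} (hξ : IsWeightedHomogeneous (fun _ : ι => g) ξ m) (q : ι) :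
    fockInner ξ (bogAn σ P t q ξ) = 0 := by
  rw [bogAn_apply, fockInner_add_right, fockInner_C_mul_right, fockInner_C_mul_right,
    fockInner_eq_zero_of_isWeightedHomogeneous_ne hξ (isWeightedHomogeneous_pderiv hξ q)
      (fun h => h1 (sub_eq_self.1 h.symm)),
    fockInner_eq_zero_of_isWeightedHomogeneous_ne hξ (isWeightedHomogeneous_X_mul' hξ (σ q))
      (fun h => h1 ?_), mul_zero, mul_zero, add_zero]
  have h' : g + m - m = 0 := by rw [← h, sub_self]
  simpa using h'

/-- **`⟨B_qξ, ξ⟩ = 0`** for a graded `ξ` (`g ≠ 0`). [cite: BastiCenatiempoSchlein2021, §4] -/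
theorem fockInner_bogAn_self_of_graded {M : Type*} [AddCommGroup M] {g : M} (h1 : g ≠ 0)
    {ξ : MvPolynomial ι ℂ} {m : M} (hξ : IsWeightedHomogeneous (fun _ : ι => g) ξ m) (q : ι) :
    fockInner (bogAn σ P t q ξ) ξ = 0 := by
  rw [← conj_fockInner, fockInner_self_bogAn_of_graded h1 hξ, map_zero]

/-- **`⟨B_qξ, B_{q'}ξ⟩` for a graded `ξ`** (`2g ≠ 0`): the number-changing cross terms drop out and
`⟨B_qξ, B_{q'}ξ⟩ = γ_qγ_{q'}⟨∂_qξ, ∂_{q'}ξ⟩ + σ_qσ_{q'}(⟨∂_{σq'}ξ, ∂_{σq}ξ⟩ + [σq = σq']‖ξ‖²)`.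
[cite: BastiCenatiempoSchlein2021, Prop. 2.4, (2.14)] -/
theorem fockInner_bogAn_bogAn'_of_graded {M : Type*} [AddCommGroup M] {g : M} (h2 : 2 • g ≠ 0)
    {ξ : MvPolynomial ι ℂ} {m : M} (hξ : IsWeightedHomogeneous (fun _ : ι => g) ξ m) (q q' : ι) :
    fockInner (bogAn σ P t q ξ) (bogAn σ P t q' ξ) =
      ((bogGamma σ P t q * bogGamma σ P t q' : ℝ) : ℂ) * fockInner (pderiv q ξ) (pderiv q' ξ) +
      ((bogSigma σ P t q * bogSigma σ P t q' : ℝ) : ℂ) *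
        (fockInner (pderiv (σ q') ξ) (pderiv (σ q) ξ) + if σ q = σ q' then fockInner ξ ξ else 0) := by
  have hne : m - g ≠ g + m := by
    intro h; apply h2
    have h' : (2 : ℕ) • g = (g + m) - (m - g) := by rw [two_nsmul]; abel
    rw [h', ← h, sub_self]
  rw [bogAn_apply, bogAn_apply]
  simp only [fockInner_add_left, fockInner_add_right, fockInner_C_mul_left, fockInner_C_mul_right,
    Complex.conj_ofReal]
  rw [fockInner_eq_zero_of_isWeightedHomogeneous_ne (isWeightedHomogeneous_pderiv hξ q)
      (isWeightedHomogeneous_X_mul' hξ (σ q')) hne,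
    fockInner_eq_zero_of_isWeightedHomogeneous_ne (isWeightedHomogeneous_X_mul' hξ (σ q))
      (isWeightedHomogeneous_pderiv hξ q') hne.symm, fockInner_X_mul_X_mul]
  push_cast
  ring

/-- **`⟨ξ, B_{q'}B_{p'}ξ⟩` for a graded `ξ`** (`2g ≠ 0`): only the number-conserving words survive,
`⟨ξ, B_{q'}B_{p'}ξ⟩ = γ_{q'}σ_{p'}(⟨∂_{σp'}ξ, ∂_{q'}ξ⟩ + [q' = σp']‖ξ‖²) + σ_{q'}γ_{p'}⟨∂_{σq'}ξ, ∂_{p'}ξ⟩`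
(the pairings `a_qa_p`, `a†a†` have zero expectation).
[cite: BastiCenatiempoSchlein2021, §4 (`𝒢^{(2,V)}_N`, "a straightforward computation")] -/
theorem fockInner_self_bogAn_bogAn_of_graded {M : Type*} [AddCommGroup M] {g : M} (h2 : 2 • g ≠ 0)
    {ξ : MvPolynomial ι ℂ} {m : M} (hξ : IsWeightedHomogeneous (fun _ : ι => g) ξ m) (p' q' : ι) :
    fockInner ξ (bogAn σ P t q' (bogAn σ P t p' ξ)) =
      ((bogGamma σ P t q' * bogSigma σ P t p' : ℝ) : ℂ) *
        (fockInner (pderiv (σ p') ξ) (pderiv q' ξ) + if q' = σ p' then fockInner ξ ξ else 0) +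
      ((bogSigma σ P t q' * bogGamma σ P t p' : ℝ) : ℂ) * fockInner (pderiv (σ q') ξ) (pderiv p' ξ) := by
  have hD : m ≠ m - g - g := by
    intro h; apply h2
    have h' : m - (g + g) = m := by rw [← sub_sub]; exact h.symm
    rw [two_nsmul]; exact sub_eq_self.1 h'
  have hU : m ≠ g + (g + m) := by
    intro h; apply h2
    have h' : (2 : ℕ) • g = (g + (g + m)) - m := by rw [two_nsmul]; abel
    rw [h', ← h, sub_self]
  rw [bogAn_bogAn_apply]
  simp only [fockInner_add_right, fockInner_C_mul_right]
  rw [fockInner_eq_zero_of_isWeightedHomogeneous_ne hξ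
      (isWeightedHomogeneous_pderiv (isWeightedHomogeneous_pderiv hξ p') q') hD,
    fockInner_eq_zero_of_isWeightedHomogeneous_ne hξ
      (isWeightedHomogeneous_X_mul' (isWeightedHomogeneous_X_mul' hξ (σ p')) (σ q')) hU,
    pderiv_X_mul, fockInner_add_right, fockInner_X_mul_right, fockInner_X_mul_right,
    fockInner_ite_right]
  push_cast
  ring

/-- **`⟨B_qB_pξ, ξ⟩` for a graded `ξ`** (conjugate form). [cite: BastiCenatiempoSchlein2021, §4] -/
theorem fockInner_bogAn_bogAn_self_of_graded {M : Type*} [AddCommGroup M] {g : M} (h2 : 2 • g ≠ 0)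
    {ξ : MvPolynomial ι ℂ} {m : M} (hξ : IsWeightedHomogeneous (fun _ : ι => g) ξ m) (p q : ι) :
    fockInner (bogAn σ P t q (bogAn σ P t p ξ)) ξ =
      ((bogGamma σ P t q * bogSigma σ P t p : ℝ) : ℂ) *
        (fockInner (pderiv q ξ) (pderiv (σ p) ξ) + if q = σ p then fockInner ξ ξ else 0) +
      ((bogSigma σ P t q * bogGamma σ P t p : ℝ) : ℂ) * fockInner (pderiv p ξ) (pderiv (σ q) ξ) := by
  rw [← conj_fockInner, fockInner_self_bogAn_bogAn_of_graded h2 hξ, map_add, map_mul, map_mul,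
    Complex.conj_ofReal, Complex.conj_ofReal, map_add, conj_fockInner, conj_fockInner]
  congr 2
  split_ifs
  · rw [conj_fockInner]
  · rw [map_zero]

omit [DecidableEq ι] in
/-- Two vectors against three classes with four vanishing pairings. [folklore] -/
theorem fockInner_add_add₃_of_orthogonal {a b D' Z' U' : MvPolynomial ι ℂ}
    (h1 : fockInner a D' = 0) (h2 : fockInner a Z' = 0) (h3 : fockInner b Z' = 0)
    (h4 : fockInner b U' = 0) :
    fockInner (a + b) (D' + Z' + U') = fockInner a U' + fockInner b D' := by
  simp only [fockInner_add_left, fockInner_add_right, h1, h2, h3, h4, add_zero, zero_add, add_comm]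

/-- **The cubic pairings `⟨B_qξ, B_{q'}B_{p'}ξ⟩` for a graded `ξ`** (`g ≠ 0`): only
`⟨a_qξ, a†a†ξ⟩` and `⟨a†ξ, aaξ⟩` survive, and in annihilation form
`⟨B_qξ, B_{q'}B_{p'}ξ⟩ = γ_qσ_{q'}σ_{p'}⟨∂_{σp'}∂_{σq'}∂_qξ, ξ⟩ + σ_qγ_{q'}γ_{p'}⟨ξ, ∂_{σq}∂_{q'}∂_{p'}ξ⟩`
— the structure `a†a†a† + h.c.` of the cubic terms `𝒞_N`, `F₁`–`F₃`.
[cite: BastiCenatiempoSchlein2021, §4 (`𝒢^{(3)}_N`)] -/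
theorem fockInner_bogAn_bogAn_bogAn_of_graded {M : Type*} [AddCommGroup M] {g : M} (h1 : g ≠ 0)
    {ξ : MvPolynomial ι ℂ} {m : M} (hξ : IsWeightedHomogeneous (fun _ : ι => g) ξ m) (q p' q' : ι) :
    fockInner (bogAn σ P t q ξ) (bogAn σ P t q' (bogAn σ P t p' ξ)) =
      ((bogGamma σ P t q * (bogSigma σ P t q' * bogSigma σ P t p') : ℝ) : ℂ) *
        fockInner (pderiv (σ p') (pderiv (σ q') (pderiv q ξ))) ξ +
      ((bogSigma σ P t q * (bogGamma σ P t q' * bogGamma σ P t p') : ℝ) : ℂ) *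
        fockInner ξ (pderiv (σ q) (pderiv q' (pderiv p' ξ))) := by
  have ha : IsWeightedHomogeneous (fun _ : ι => g) (C ((bogGamma σ P t q : ℝ) : ℂ) * pderiv q ξ) (m - g) :=
    (isWeightedHomogeneous_pderiv hξ q).C_mul _
  have hb : IsWeightedHomogeneous (fun _ : ι => g) (C ((bogSigma σ P t q : ℝ) : ℂ) * (X (σ q) * ξ))
      (g + m) := (isWeightedHomogeneous_X_mul' hξ (σ q)).C_mul _
  have hD : ∀ x : ℂ, IsWeightedHomogeneous (fun _ : ι => g) (C x * pderiv q' (pderiv p' ξ)) (m - g - g) :=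
    fun x => (isWeightedHomogeneous_pderiv (isWeightedHomogeneous_pderiv hξ p') q').C_mul _
  have hZ : ∀ (a b c d : ι) (x y : ℂ), IsWeightedHomogeneous (fun _ : ι => g)
      (C x * pderiv a (X b * ξ) + C y * (X c * pderiv d ξ)) m := by
    intro a b c d x y
    refine (isWeightedHomogeneous_C_mul' ((isWeightedHomogeneous_pderiv
      (isWeightedHomogeneous_X_mul' hξ b) a).of_eq (by abel)) x).add
      (isWeightedHomogeneous_C_mul' ((isWeightedHomogeneous_X_mul'
        (isWeightedHomogeneous_pderiv hξ d) c).of_eq (by abel)) y)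
  have hU : ∀ x : ℂ, IsWeightedHomogeneous (fun _ : ι => g) (C x * (X (σ q') * (X (σ p') * ξ)))
      (g + (g + m)) := fun x => (isWeightedHomogeneous_X_mul' (isWeightedHomogeneous_X_mul' hξ (σ p')) (σ q')).C_mul _
  have haD : m - g ≠ m - g - g := fun h => h1 (sub_eq_self.1 h.symm)
  have haZ : m - g ≠ m := fun h => h1 (sub_eq_self.1 h)
  have hbZ : g + m ≠ m := fun h => h1 (by simpa using h)
  have hbU : g + m ≠ g + (g + m) := fun h => h1 (by simpa using h.symm)
  rw [bogAn_apply, bogAn_bogAn_apply,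
    fockInner_add_add₃_of_orthogonal
      (fockInner_eq_zero_of_isWeightedHomogeneous_ne ha (hD _) haD)
      (fockInner_eq_zero_of_isWeightedHomogeneous_ne ha (hZ _ _ _ _ _ _) haZ)
      (fockInner_eq_zero_of_isWeightedHomogeneous_ne hb (hZ _ _ _ _ _ _) hbZ)
      (fockInner_eq_zero_of_isWeightedHomogeneous_ne hb (hU _) hbU),
    fockInner_C_mul_left, fockInner_C_mul_right, fockInner_C_mul_left, fockInner_C_mul_right,
    Complex.conj_ofReal, Complex.conj_ofReal, fockInner_X_mul_right, fockInner_X_mul_right,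
    fockInner_X_mul_left]
  push_cast
  ring

end QuarticWords


/-! ## II. The momentum-conserving quartic form -/

section MomentumSums

variable {ι : Type*} [Fintype ι] [DecidableEq ι] {z : ι} {σ : ι → ι} {P : Finset ι} {N₀ : ℝ}
  {t : ι → ℝ} {e : ι → Momentum}

/-! ### Momentum bookkeeping on the modes -/

omit [Fintype ι] [DecidableEq ι] in
/-- `e q = -e p ↔ q = σp` (injective labels, `e ∘ σ = -e`). [folklore] -/
theorem momentum_eq_neg_iff (he : Function.Injective e) (heσ : ∀ p, e (σ p) = -e p) (p q : ι) :
    e q = -e p ↔ q = σ p := by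
  rw [← heσ p, he.eq_iff]

/-- Collapse `∑_x [e a = e x] F(x) = F(a)`. [folklore] -/
theorem sum_ite_momentum_eq (he : Function.Injective e) (a : ι) (F : ι → ℂ) :
    ∑ x, (if e a = e x then F x else 0) = F a := by
  simp only [he.eq_iff, Finset.sum_ite_eq, Finset.mem_univ, if_true]

/-- Collapse `∑_x [e a + e x = 0] F(x) = F(σa)`. [folklore] -/
theorem sum_ite_momentum_add_eq_zero (he : Function.Injective e) (heσ : ∀ p, e (σ p) = -e p) (a : ι)
    (F : ι → ℂ) : ∑ x, (if e a + e x = 0 then F x else 0) = F (σ a) := by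
  have h : ∀ x, (e a + e x = 0) ↔ (σ a = x) := by
    intro x
    rw [add_eq_zero_iff_neg_eq, eq_comm, momentum_eq_neg_iff he heσ, eq_comm]
  simp only [h, Finset.sum_ite_eq, Finset.mem_univ, if_true]

/-- Collapse `∑_x [0 = e a + e x] F(x) = F(σa)`. [folklore] -/
theorem sum_ite_zero_eq_momentum_add (he : Function.Injective e) (heσ : ∀ p, e (σ p) = -e p) (a : ι)
    (F : ι → ℂ) : ∑ x, (if 0 = e a + e x then F x else 0) = F (σ a) := by
  simp only [eq_comm (a := (0 : Momentum)), sum_ite_momentum_add_eq_zero he heσ]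

/-- Collapse `∑_x [e x = 0] F(x) = F(z)`. [folklore] -/
theorem sum_ite_momentum_eq_zero (he : Function.Injective e) (hez : e z = 0) (F : ι → ℂ) :
    ∑ x, (if e x = 0 then F x else 0) = F z := by
  have h : ∀ x, (e x = 0) ↔ (x = z) := fun x => by rw [← hez, he.eq_iff]
  simp only [h, Finset.sum_ite_eq', Finset.mem_univ, if_true]

/-- Collapse `∑_x [0 = e x] F(x) = F(z)`. [folklore] -/
theorem sum_ite_zero_eq_momentum (he : Function.Injective e) (hez : e z = 0) (F : ι → ℂ) :
    ∑ x, (if 0 = e x then F x else 0) = F z := by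
  simp only [eq_comm (a := (0 : Momentum)), sum_ite_momentum_eq_zero he hez]

/-! ### The momentum-conserving pair coefficient and its Weyl reduction -/

/-- The **pair coefficient** `c(p,q,p',q') = [e p + e q = e p' + e q'] W(e p' - e p)` of the
second-quantised interaction `(2|Λ|)⁻¹∑ V̂(r) a†_{p+r}a†_qa_{q+r}a_p` (momentum transfer `r = p'-p`).
[cite: BastiCenatiempoSchlein2021, (2.1)] -/
def pairCoeff' (e : ι → Momentum) (W : Momentum → ℂ) (p q p' q' : ι) : ℂ :=
  if e p + e q = e p' + e q' then W (e p' - e p) else 0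

/-- **The Weyl reduction of the momentum-conserving quartic form** for `a_zξ = 0`:
`∑ c⟨A_qA_pξ, A_{q'}A_{p'}ξ⟩ = ℒ⁽⁴⁾ + √N₀·ℒ⁽³⁾ + N₀·ℒ⁽²⁾ + N₀²W(0)‖ξ‖²` with the four cubic and the
quadratic momentum sums written out (statement in the module docstring; `ℒ⁽¹⁾` is absent).
[cite: BastiCenatiempoSchlein2021, (3.1)–(3.2)] -/
theorem sum_pairCoeff_fockInner_conjPair_conjPair (hP : ∀ p ∈ P, σ p ∉ P) (hσz : σ z = z)
    (hN₀ : 0 ≤ N₀) (he : Function.Injective e) (hez : e z = 0) (heσ : ∀ p, e (σ p) = -e p)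
    (W : Momentum → ℂ) {ξ : MvPolynomial ι ℂ} (hξ : pderiv z ξ = 0) :
    ∑ p, ∑ q, ∑ p', ∑ q', pairCoeff' e W p q p' q' *
        fockInner (conjAn z σ P N₀ t q (conjAn z σ P N₀ t p ξ))
          (conjAn z σ P N₀ t q' (conjAn z σ P N₀ t p' ξ)) =
      (∑ p, ∑ q, ∑ p', ∑ q', pairCoeff' e W p q p' q' *
          fockInner (bogAn σ P t q (bogAn σ P t p ξ)) (bogAn σ P t q' (bogAn σ P t p' ξ))) +
      (Real.sqrt N₀ : ℂ) *
        ((∑ p, ∑ q, ∑ q', if e p + e q = e q' then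
            W (-e p) * fockInner (bogAn σ P t q (bogAn σ P t p ξ)) (bogAn σ P t q' ξ) else 0) +
          (∑ p, ∑ q, ∑ p', if e p + e q = e p' then
            W (e p' - e p) * fockInner (bogAn σ P t q (bogAn σ P t p ξ)) (bogAn σ P t p' ξ) else 0) +
          (∑ q, ∑ p', ∑ q', if e q = e p' + e q' then
            W (e p') * fockInner (bogAn σ P t q ξ) (bogAn σ P t q' (bogAn σ P t p' ξ)) else 0) +
          (∑ p, ∑ p', ∑ q', if e p = e p' + e q' then
            W (e p' - e p) * fockInner (bogAn σ P t p ξ) (bogAn σ P t q' (bogAn σ P t p' ξ)) else 0)) +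
      (N₀ : ℂ) *
        ((∑ p, (2 * W 0 + W (e p) + W (-e p)) * fockInner (bogAn σ P t p ξ) (bogAn σ P t p ξ)) +
          ∑ p, (W (-e p) * fockInner (bogAn σ P t (σ p) (bogAn σ P t p ξ)) ξ +
            W (e p) * fockInner ξ (bogAn σ P t (σ p) (bogAn σ P t p ξ)))) +
      (N₀ : ℂ) ^ 2 * (W 0 * fockInner ξ ξ) := by
  have hBz : bogAn σ P t z ξ = 0 := bogAn_z_of hP hσz hξ
  rw [show (pairCoeff' e W) = fun p q p' q' => if e p + e q = e p' + e q' then W (e p' - e p) else 0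
    from rfl, sum_fockInner_conjPair_conjPair hN₀]
  simp only [hez, zero_add, add_zero, sub_zero, zero_sub, ite_mul, zero_mul,
    sum_ite_momentum_eq he, sum_ite_momentum_add_eq_zero he heσ, sum_ite_zero_eq_momentum_add he heσ,
    sum_ite_momentum_eq_zero he hez, sum_ite_zero_eq_momentum he hez, hBz, fockInner_zero_left,
    fockInner_zero_right, mul_zero, sub_self, if_true, add_zero]
  have hsq : (Real.sqrt N₀ : ℂ) * (Real.sqrt N₀ : ℂ) = (N₀ : ℂ) := by
    rw [← Complex.ofReal_mul, Real.mul_self_sqrt hN₀]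
  simp only [mul_add, ← mul_assoc, hsq]
  simp only [two_mul, add_mul, Finset.sum_add_distrib]
  ring

end MomentumSums

end Fock

end Literature.MathematicalPhysics.QuantumManyBody.BoseGas

end
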